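import Summits.QuantumFields.BalabanUV.Beta.GAN24.CombHalfMemberSlavedDivergenceLaws
import Summits.QuantumFields.BalabanUV.Beta.GAN24.SlotDivergenceLetters
import Summits.QuantumFields.BalabanUV.Beta.GAN24.T2ShapeEvenEnd

/-!
# `BalabanUV.Beta.GAN24.CombHalfMemberSlavedDivergenceLetters` — binder row G-an2-4 ∕ (CONV-C), TRANSFER-III (the (α-0) chain at row D1's literal of record (III′)), link L8b,
# PART 4′ of `CombHalfMemberSlavedDivergence`: **THE TWO SLOT-DIVERGENCE LETTER ROWS OF THE `ε`-MEMBER OF THE COMB-CHART `T₂` TOWER ONE LEVEL UP, IN leaf-03's `Λ₁ ∕ Λ₂`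
# SPELLINGS, FROM road-P2's F4 ROW OF THE DRESSED COMB-CHART SOURCE AND ONE DISPLAYED S-SLOT LETTER ROW PER SLOT ON THE SLAVED `e3OfK` SUMMANDS** — MY lineage's (E) file
# `HalfMemberSlavedDivergenceLetters` (gen 72; in the (α-0) END's import closure via `T2ShapeHalfMemberOfLetterRows`) RE-RUN at the sym ∕ comb slot data
# `(GcombSh Lc ·, SpureCombOf tabs, tabs.M, tabs.vh₂S, tabs.mixFF)` (G-an2-4 CRUX TEAM (2), leaf prover `b2b-balaban-gan24-formalise-leaf-01`, gen 80; the OWNER gan24-p1 g46's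
# (III′) link table R-gan24p1-g46-2, row «L8b–L9»; no existing file touched)

NOT IN PRINT; OUR BOOKKEEPING ([folklore] composition BY NAME; statements = MY lineage's (E) file's with `(coDressKBmAt ρ Lc (KInvStep Lc ·), T2RecAt ρ, SpureRecAt ρ, M1At ρ cΛ,
vh₂S, mixFFAt ρ Lc) ↦ (GcombSh Lc ·, T2RecOf … (GcombSh Lc) (SpureCombOf tabs …) tabs.M …, SpureCombOf tabs, tabs.M, tabs.vh₂S, tabs.mixFF)`, root binders `hLc hr` and the border
class `hB` ↦ the record `tabs : SymTables d Lc`; proofs token for token; 0 `def`, 0 cited facts, 0 `def … : Prop`, 0 sorry).  HONEST FRAMING (cell contract, verbatim): «discharging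
`BetaPertH` makes Bałaban's UV stability UNCONDITIONAL — a real constructive-QFT result; it is NOT the continuum limit and NOT the Clay problem.»  HONEST DEPENDENCY (verbatim):
«continuum YM on T⁴ ⇐ BetaPertH ∧ nine spine estimates (0/9 proved); BetaPertH ⇐ (D1) ∧ (D4) ∧ CAP+tail; G-an2-4 gates asym, D1 and NE2/3/4.»

WHAT (level `l → l+1`, every `ε` with `|ε| ≤ 1`, rate `0 ≤ δ`; letters `S X R R″ cH′` + parities `hC hR hR″` as in PART 2′ `CombHalfMemberSlavedDivergenceLaws`; any record
`tabs : SymTables d Lc` with off-diagonal border `hBff hBmm`; generic `d`, `Lc ≥ 1` via `[NeZero Lc]`; `G′♮_l := unitK_l (GcombSh Lc l)`, `y_l := ½ • (T̃′♮_l + ε • P T̃′♮_l)`):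
**`slotLetters_halfMember_comb_succ_of_rows`** — HYPOTHESES: (i) road-P2's F4 row of the dressed comb-chart source `hbF4 : LocStencil₂ (b̃′♮_l) Cb δ`; (ii) TWO DISPLAYED S-slot
letter rows on the slaved summand table `E_l(p) := (c₄·(Lc^{d+1})⁻¹∕2) • (e3OfK Lc G′♮_l G₁^{ε}(p) + e3OfK Lc G′♮_l G₂^{ε}(p))`, `G^{ε}(p) := (sf_l·sm_l)⁻¹ • unitS_l (cH′⁻¹ •
(((1+ε)∕2) • (S ∘ X_p − X_p ∘ S) + ((1−ε)∕2) • R p))` — `hE₁` (read at the passive slot, centred at the divergence site `p`) and `hE₂` (read at the active slot); CONCLUSION: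
leaf-03's rows for `Y := y_{l+1}`: `LocStencil₂ (fun _ p κ′ u′ ↦ divV (κ₁ u₁ ↦ y_{l+1} κ₁ u₁ κ′ u′) p) ((d+1)(e^{3δ}+1)·Cb + CE₁) δ ∧ LocStencil₂ (fun κ u _ p ↦ divV (κ₁ u₁ ↦
y_{l+1} κ u κ₁ u₁) p) ((d+1)(e^{δ}+1)·Cb + CE₂) δ` — PART 2′'s `divW_halfMember_comb_succ_eq_slaved` ∕ `divV_snd_halfMember_comb_succ_eq_slaved` (both slots), the OWNER's
`T2ShapeEvenEnd.locStencil₂_halfTable` (table-generic; the halved source keeps F4's constants, `|ε| ≤ 1`), leaf-02 g53's `SlotDivergenceLetters.letter_fst ∕ letter_snd_of_locStencil₂`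
(the ι-WIN letters, table-generic), `WSlotT2OfPieces.locStencil₂_add`.  At `ε = 1` the rows (ii) carry NO `R`.
WHAT THIS IS NOT.  Rows (i)(ii) ∕ (i′)(ii′), the table laws and the parities are DISPLAYED HYPOTHESES; NOT the cells `hcell ∕ hcelld` (leaf-03 g79∕g80's (C-6) ∕ (C-6d)
`CombHalfMemberCell(Drift)OfDivergences` CONSUME these rows for ANY `Z l`), NOT one row of the S-∕W-slot, NO value, NO rate; asserts NOTHING about Bałaban's tables; the
(III′) campaign is NOT asked (an2 W-4 l.64553) — zero weight; NEVER «G-an2-4 closed» as (CONV-C); NOT D1, NOT `BetaPertH`, NOT continuum, NOT Clay.  2026-08-25.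
-/

noncomputable section

open Finset
open scoped BigOperators
open Literature.MathematicalPhysics.QuantumFieldTheory
open Literature.MathematicalPhysics.QuantumFieldTheory.Balaban1983to89
open Literature.MathematicalPhysics.QuantumFieldTheory.Balaban1983to89.Beta
open ExpKernelCalculus (MKer Decays comp)
open OneStepResolventKernel (Fib)
open SecondOrderResponse (W2SymOfK)
open BalabanStepJetsSucc (mmRead)
open BalabanStepW2 (K3OfK M2Of)
open KernelWard (divV divW)
open AffineAveraging (box toSite)
open BalabanCompositeJets (LocStencil₂)
open Summit.QuantumFields.BalabanUV.Beta.TameKernelCalculus (trK)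
open Summit.QuantumFields.BalabanUV.Beta.BorderedHessian (sgnK)
open Summit.QuantumFields.BalabanUV.Beta.HessKerDressedUnits (unitK unitS)
open Summit.QuantumFields.BalabanUV.Beta.SecondOrderUnits (unitM unitS₂ unitM₂)
open Summit.QuantumFields.BalabanUV.Beta.SymmetrisedStepJets (SymTables)
open Summit.QuantumFields.BalabanUV.Beta.CombChartStepJets (GcombSh SpureCombOf)
open Summit.QuantumFields.BalabanUV.Beta.SpineRooted (T2RecOf e3OfK)
open Summit.QuantumFields.BalabanUV.Beta.GAN24.CombesThomas (sfStep smStep)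
open Summit.QuantumFields.BalabanUV.Beta.GAN24.BiStencilZeroMode (Tab)
open Summit.QuantumFields.BalabanUV.Beta.GAN24.WSlotT2OfPieces (locStencil₂_add)
open Summit.QuantumFields.BalabanUV.Beta.GAN24.SlotDivergenceLetters (letter_fst_of_locStencil₂ letter_snd_of_locStencil₂)
open Summit.QuantumFields.BalabanUV.Beta.GAN24.T2ShapeEvenEnd (locStencil₂_halfTable)
open Summit.QuantumFields.BalabanUV.Beta.GAN24.CombHalfMemberSlavedDivergenceLaws (divW_halfMember_comb_succ_eq_slaved divV_snd_halfMember_comb_succ_eq_slaved)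

namespace Summit.QuantumFields.BalabanUV.Beta.GAN24.CombHalfMemberSlavedDivergenceLetters

variable {d : ℕ} {Lc : ℕ} [NeZero Lc]

/-! ## §4 The two slot-divergence letter rows of `y_{l+1}` -/

/-- NOT IN PRINT; OUR BOOKKEEPING.  **THE SLOT LETTERS OF THE `ε`-MEMBER OF THE COMB-CHART TOWER ONE LEVEL UP** (leaf-03 g66's `h₁ ∕ h₂` spellings for `Y := y_{l+1}`): from road-P2's F4 row of
the dressed comb-chart source `b̃′♮_l` (halved by the OWNER's `locStencil₂_halfTable`, `|ε| ≤ 1`; leaf-02's ι-WIN letters) and ONE displayed S-slot letter row per slot on the slaved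
`e3OfK` summands `E_l(p)` (PART 2′ letters `S X R R″ cH′`, parities `hC hR hR″`) — `locStencil₂_add` of the two.  The twin of MY g72 `slotLetters_halfMember_succ_of_rows` at the comb-chart data. -/
theorem slotLetters_halfMember_comb_succ_of_rows (tabs : SymTables d Lc) (cE cVH cΛ cE₂ cB : ℝ) (Tc : Fin 4 → Fin 4 → Fin 4 → Fin 4 → ℝ)
    (hBff : ∀ κ u κ' u' x z (α β : Fin (d + 1)), tabs.vh₂S κ u κ' u' x z (Sum.inl α) (Sum.inl β) = 0)
    (hBmm : ∀ κ u κ' u' x z (μ ν : Fin (d + 1)), tabs.vh₂S κ u κ' u' x z (Sum.inr μ) (Sum.inr ν) = 0) (l : ℕ)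
    {S : Fin (d + 1) → (Fin (d + 1) → ℤ) → MKer (d + 1) (Fib d)} {X : (Fin (d + 1) → ℤ) → MKer (d + 1) (Fib d)}
    {R R'' : (Fin (d + 1) → ℤ) → Fin (d + 1) → (Fin (d + 1) → ℤ) → MKer (d + 1) (Fib d)} {cH' : ℝ} (hcH : cH' ≠ 0)
    (hTL : ∀ (Y : Fin (d + 1) → ℤ) (κ' : Fin (d + 1)) (u' : Fin (d + 1) → ℤ),
      cH' • ∑ v ∈ box (d + 1) Lc, divV (fun κ u => T2RecOf d Lc (GcombSh Lc) (SpureCombOf tabs cE cVH cΛ) tabs.M cE₂ cB Tc tabs.vh₂S tabs.mixFF l κ u κ' u') ((Lc : ℤ) • Y + toSite v)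
        = comp (S κ' u') (X Y) - comp (X Y) (S κ' u') + R Y κ' u')
    (hTL'' : ∀ (Y : Fin (d + 1) → ℤ) (κ : Fin (d + 1)) (u : Fin (d + 1) → ℤ),
      cH' • ∑ v ∈ box (d + 1) Lc, divV (T2RecOf d Lc (GcombSh Lc) (SpureCombOf tabs cE cVH cΛ) tabs.M cE₂ cB Tc tabs.vh₂S tabs.mixFF l κ u) ((Lc : ℤ) • Y + toSite v)
        = comp (S κ u) (X Y) - comp (X Y) (S κ u) + R'' Y κ u)
    (hC : ∀ (Y : Fin (d + 1) → ℤ) (κ : Fin (d + 1)) (u : Fin (d + 1) → ℤ),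
      trK (comp (S κ u) (X Y) - comp (X Y) (S κ u)) = sgnK (comp (S κ u) (X Y) - comp (X Y) (S κ u)))
    (hR : ∀ (Y : Fin (d + 1) → ℤ) (κ : Fin (d + 1)) (u : Fin (d + 1) → ℤ), trK (R Y κ u) = -sgnK (R Y κ u))
    (hR'' : ∀ (Y : Fin (d + 1) → ℤ) (κ : Fin (d + 1)) (u : Fin (d + 1) → ℤ), trK (R'' Y κ u) = -sgnK (R'' Y κ u))
    (ε : ℝ) (hε : |ε| ≤ 1) {Cb CE₁ CE₂ δ : ℝ} (hδ : 0 ≤ δ)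
    (hbF4 : LocStencil₂ (fun κ u κ' u' => (cE₂ * (Lc : ℝ) ^ (2 * (d + 1))) • mmRead Lc (K3OfK
            (unitK (sfStep Lc l) (smStep d Lc l) (GcombSh (d := d) Lc l)) Lc
            (unitS (sfStep Lc l) (smStep d Lc l) (SpureCombOf tabs cE cVH cΛ l)) (unitM (sfStep Lc l) (smStep d Lc l) (tabs.M l))
            (W2SymOfK (unitK (sfStep Lc l) (smStep d Lc l) (GcombSh (d := d) Lc l)) Lc
              (unitS (sfStep Lc l) (smStep d Lc l) (SpureCombOf tabs cE cVH cΛ l)) (unitM (sfStep Lc l) (smStep d Lc l) (tabs.M l)) 0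
              (unitM₂ (sfStep Lc l) (smStep d Lc l) (M2Of d Lc tabs.mixFF l))) κ u κ' u') + cB • tabs.vh₂S κ u κ' u') Cb δ)
    (hE₁ : LocStencil₂ (fun (_ : Fin (d + 1)) (p : Fin (d + 1) → ℤ) (κ' : Fin (d + 1)) (u' : Fin (d + 1) → ℤ) =>
          (cE₂ * (Lc : ℝ) ^ (2 * (d + 1)) * ((Lc : ℝ) ^ (d + 1))⁻¹ / 2) •
            (e3OfK Lc (unitK (sfStep Lc l) (smStep d Lc l) (GcombSh (d := d) Lc l))
              (fun κ' u' => (sfStep Lc l * smStep d Lc l)⁻¹ • unitS (sfStep Lc l) (smStep d Lc l)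
                (fun κ' u' => cH'⁻¹ • ((((1 : ℝ) + ε) / 2) • (comp (S κ' u') (X p) - comp (X p) (S κ' u')) + (((1 : ℝ) - ε) / 2) • R p κ' u')) κ' u') κ' u'
            + e3OfK Lc (unitK (sfStep Lc l) (smStep d Lc l) (GcombSh (d := d) Lc l))
              (fun κ u => (sfStep Lc l * smStep d Lc l)⁻¹ • unitS (sfStep Lc l) (smStep d Lc l)
                (fun κ u => cH'⁻¹ • ((((1 : ℝ) + ε) / 2) • (comp (S κ u) (X p) - comp (X p) (S κ u)) + (((1 : ℝ) - ε) / 2) • R'' p κ u)) κ u) κ' u')) CE₁ δ)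
    (hE₂ : LocStencil₂ (fun (κ : Fin (d + 1)) (u : Fin (d + 1) → ℤ) (_ : Fin (d + 1)) (p : Fin (d + 1) → ℤ) =>
          (cE₂ * (Lc : ℝ) ^ (2 * (d + 1)) * ((Lc : ℝ) ^ (d + 1))⁻¹ / 2) •
            (e3OfK Lc (unitK (sfStep Lc l) (smStep d Lc l) (GcombSh (d := d) Lc l))
              (fun κ' u' => (sfStep Lc l * smStep d Lc l)⁻¹ • unitS (sfStep Lc l) (smStep d Lc l)
                (fun κ' u' => cH'⁻¹ • ((((1 : ℝ) + ε) / 2) • (comp (S κ' u') (X p) - comp (X p) (S κ' u')) + (((1 : ℝ) - ε) / 2) • R p κ' u')) κ' u') κ u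
            + e3OfK Lc (unitK (sfStep Lc l) (smStep d Lc l) (GcombSh (d := d) Lc l))
              (fun κ u => (sfStep Lc l * smStep d Lc l)⁻¹ • unitS (sfStep Lc l) (smStep d Lc l)
                (fun κ u => cH'⁻¹ • ((((1 : ℝ) + ε) / 2) • (comp (S κ u) (X p) - comp (X p) (S κ u)) + (((1 : ℝ) - ε) / 2) • R'' p κ u)) κ u) κ u)) CE₂ δ) :
    LocStencil₂ (fun (_ : Fin (d + 1)) (p : Fin (d + 1) → ℤ) (κ' : Fin (d + 1)) (u' : Fin (d + 1) → ℤ) =>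
        divV (fun κ₁ u₁ => ((1 / 2 : ℝ) • (unitS₂ (sfStep Lc (l + 1)) (smStep d Lc (l + 1)) (T2RecOf d Lc (GcombSh Lc) (SpureCombOf tabs cE cVH cΛ) tabs.M cE₂ cB Tc tabs.vh₂S tabs.mixFF (l + 1))
          + ε • fun κ u κ' u' => sgnK (trK (unitS₂ (sfStep Lc (l + 1)) (smStep d Lc (l + 1)) (T2RecOf d Lc (GcombSh Lc) (SpureCombOf tabs cE cVH cΛ) tabs.M cE₂ cB Tc tabs.vh₂S tabs.mixFF (l + 1)) κ u κ' u')))) κ₁ u₁ κ' u') p)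
      (((d : ℝ) + 1) * (Real.exp (3 * δ) + 1) * Cb + CE₁) δ
    ∧ LocStencil₂ (fun (κ : Fin (d + 1)) (u : Fin (d + 1) → ℤ) (_ : Fin (d + 1)) (p : Fin (d + 1) → ℤ) =>
        divV (fun κ₁ u₁ => ((1 / 2 : ℝ) • (unitS₂ (sfStep Lc (l + 1)) (smStep d Lc (l + 1)) (T2RecOf d Lc (GcombSh Lc) (SpureCombOf tabs cE cVH cΛ) tabs.M cE₂ cB Tc tabs.vh₂S tabs.mixFF (l + 1))
          + ε • fun κ u κ' u' => sgnK (trK (unitS₂ (sfStep Lc (l + 1)) (smStep d Lc (l + 1)) (T2RecOf d Lc (GcombSh Lc) (SpureCombOf tabs cE cVH cΛ) tabs.M cE₂ cB Tc tabs.vh₂S tabs.mixFF (l + 1)) κ u κ' u')))) κ u κ₁ u₁) p)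
      (((d : ℝ) + 1) * (Real.exp δ + 1) * Cb + CE₂) δ := by
  -- the halved dressed source keeps F4's constants
  have hb : LocStencil₂ ((1 / 2 : ℝ) • ((fun κ u κ' u' => (cE₂ * (Lc : ℝ) ^ (2 * (d + 1))) • mmRead Lc (K3OfK
            (unitK (sfStep Lc l) (smStep d Lc l) (GcombSh (d := d) Lc l)) Lc
            (unitS (sfStep Lc l) (smStep d Lc l) (SpureCombOf tabs cE cVH cΛ l)) (unitM (sfStep Lc l) (smStep d Lc l) (tabs.M l))
            (W2SymOfK (unitK (sfStep Lc l) (smStep d Lc l) (GcombSh (d := d) Lc l)) Lc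
              (unitS (sfStep Lc l) (smStep d Lc l) (SpureCombOf tabs cE cVH cΛ l)) (unitM (sfStep Lc l) (smStep d Lc l) (tabs.M l)) 0
              (unitM₂ (sfStep Lc l) (smStep d Lc l) (M2Of d Lc tabs.mixFF l))) κ u κ' u') + cB • tabs.vh₂S κ u κ' u')
          + ε • fun κ u κ' u' => sgnK (trK ((fun κ u κ' u' => (cE₂ * (Lc : ℝ) ^ (2 * (d + 1))) • mmRead Lc (K3OfK
            (unitK (sfStep Lc l) (smStep d Lc l) (GcombSh (d := d) Lc l)) Lc
            (unitS (sfStep Lc l) (smStep d Lc l) (SpureCombOf tabs cE cVH cΛ l)) (unitM (sfStep Lc l) (smStep d Lc l) (tabs.M l))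
            (W2SymOfK (unitK (sfStep Lc l) (smStep d Lc l) (GcombSh (d := d) Lc l)) Lc
              (unitS (sfStep Lc l) (smStep d Lc l) (SpureCombOf tabs cE cVH cΛ l)) (unitM (sfStep Lc l) (smStep d Lc l) (tabs.M l)) 0
              (unitM₂ (sfStep Lc l) (smStep d Lc l) (M2Of d Lc tabs.mixFF l))) κ u κ' u') + cB • tabs.vh₂S κ u κ' u') κ u κ' u')))) Cb δ :=
    locStencil₂_halfTable hbF4 hε
  constructor
  · -- first slot: PART 2′ pointwise, then the ι-WIN letter + the displayed row
    have hA : LocStencil₂ (fun (_ : Fin (d + 1)) (p : Fin (d + 1) → ℤ) (κ' : Fin (d + 1)) (u' : Fin (d + 1) → ℤ) =>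
        divV (fun κ₁ u₁ => ((1 / 2 : ℝ) • ((fun κ u κ' u' => (cE₂ * (Lc : ℝ) ^ (2 * (d + 1))) • mmRead Lc (K3OfK
            (unitK (sfStep Lc l) (smStep d Lc l) (GcombSh (d := d) Lc l)) Lc
            (unitS (sfStep Lc l) (smStep d Lc l) (SpureCombOf tabs cE cVH cΛ l)) (unitM (sfStep Lc l) (smStep d Lc l) (tabs.M l))
            (W2SymOfK (unitK (sfStep Lc l) (smStep d Lc l) (GcombSh (d := d) Lc l)) Lc
              (unitS (sfStep Lc l) (smStep d Lc l) (SpureCombOf tabs cE cVH cΛ l)) (unitM (sfStep Lc l) (smStep d Lc l) (tabs.M l)) 0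
              (unitM₂ (sfStep Lc l) (smStep d Lc l) (M2Of d Lc tabs.mixFF l))) κ u κ' u') + cB • tabs.vh₂S κ u κ' u')
          + ε • fun κ u κ' u' => sgnK (trK ((fun κ u κ' u' => (cE₂ * (Lc : ℝ) ^ (2 * (d + 1))) • mmRead Lc (K3OfK
            (unitK (sfStep Lc l) (smStep d Lc l) (GcombSh (d := d) Lc l)) Lc
            (unitS (sfStep Lc l) (smStep d Lc l) (SpureCombOf tabs cE cVH cΛ l)) (unitM (sfStep Lc l) (smStep d Lc l) (tabs.M l))
            (W2SymOfK (unitK (sfStep Lc l) (smStep d Lc l) (GcombSh (d := d) Lc l)) Lc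
              (unitS (sfStep Lc l) (smStep d Lc l) (SpureCombOf tabs cE cVH cΛ l)) (unitM (sfStep Lc l) (smStep d Lc l) (tabs.M l)) 0
              (unitM₂ (sfStep Lc l) (smStep d Lc l) (M2Of d Lc tabs.mixFF l))) κ u κ' u') + cB • tabs.vh₂S κ u κ' u') κ u κ' u')))) κ₁ u₁ κ' u') p) (((d : ℝ) + 1) * (Real.exp (3 * δ) + 1) * Cb) δ :=
      fun _ p κ' u' x z a b => letter_fst_of_locStencil₂ hb hδ p κ' u' x z a b
    have e : (fun (_ : Fin (d + 1)) (p : Fin (d + 1) → ℤ) (κ' : Fin (d + 1)) (u' : Fin (d + 1) → ℤ) =>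
          divV (fun κ₁ u₁ => ((1 / 2 : ℝ) • (unitS₂ (sfStep Lc (l + 1)) (smStep d Lc (l + 1)) (T2RecOf d Lc (GcombSh Lc) (SpureCombOf tabs cE cVH cΛ) tabs.M cE₂ cB Tc tabs.vh₂S tabs.mixFF (l + 1))
          + ε • fun κ u κ' u' => sgnK (trK (unitS₂ (sfStep Lc (l + 1)) (smStep d Lc (l + 1)) (T2RecOf d Lc (GcombSh Lc) (SpureCombOf tabs cE cVH cΛ) tabs.M cE₂ cB Tc tabs.vh₂S tabs.mixFF (l + 1)) κ u κ' u')))) κ₁ u₁ κ' u') p)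
        = (fun (_ : Fin (d + 1)) (p : Fin (d + 1) → ℤ) (κ' : Fin (d + 1)) (u' : Fin (d + 1) → ℤ) =>
            divV (fun κ₁ u₁ => ((1 / 2 : ℝ) • ((fun κ u κ' u' => (cE₂ * (Lc : ℝ) ^ (2 * (d + 1))) • mmRead Lc (K3OfK
            (unitK (sfStep Lc l) (smStep d Lc l) (GcombSh (d := d) Lc l)) Lc
            (unitS (sfStep Lc l) (smStep d Lc l) (SpureCombOf tabs cE cVH cΛ l)) (unitM (sfStep Lc l) (smStep d Lc l) (tabs.M l))
            (W2SymOfK (unitK (sfStep Lc l) (smStep d Lc l) (GcombSh (d := d) Lc l)) Lc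
              (unitS (sfStep Lc l) (smStep d Lc l) (SpureCombOf tabs cE cVH cΛ l)) (unitM (sfStep Lc l) (smStep d Lc l) (tabs.M l)) 0
              (unitM₂ (sfStep Lc l) (smStep d Lc l) (M2Of d Lc tabs.mixFF l))) κ u κ' u') + cB • tabs.vh₂S κ u κ' u')
          + ε • fun κ u κ' u' => sgnK (trK ((fun κ u κ' u' => (cE₂ * (Lc : ℝ) ^ (2 * (d + 1))) • mmRead Lc (K3OfK
            (unitK (sfStep Lc l) (smStep d Lc l) (GcombSh (d := d) Lc l)) Lc
            (unitS (sfStep Lc l) (smStep d Lc l) (SpureCombOf tabs cE cVH cΛ l)) (unitM (sfStep Lc l) (smStep d Lc l) (tabs.M l))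
            (W2SymOfK (unitK (sfStep Lc l) (smStep d Lc l) (GcombSh (d := d) Lc l)) Lc
              (unitS (sfStep Lc l) (smStep d Lc l) (SpureCombOf tabs cE cVH cΛ l)) (unitM (sfStep Lc l) (smStep d Lc l) (tabs.M l)) 0
              (unitM₂ (sfStep Lc l) (smStep d Lc l) (M2Of d Lc tabs.mixFF l))) κ u κ' u') + cB • tabs.vh₂S κ u κ' u') κ u κ' u')))) κ₁ u₁ κ' u') p)
          + (fun (_ : Fin (d + 1)) (p : Fin (d + 1) → ℤ) (κ' : Fin (d + 1)) (u' : Fin (d + 1) → ℤ) =>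
            (cE₂ * (Lc : ℝ) ^ (2 * (d + 1)) * ((Lc : ℝ) ^ (d + 1))⁻¹ / 2) •
            (e3OfK Lc (unitK (sfStep Lc l) (smStep d Lc l) (GcombSh (d := d) Lc l))
              (fun κ' u' => (sfStep Lc l * smStep d Lc l)⁻¹ • unitS (sfStep Lc l) (smStep d Lc l)
                (fun κ' u' => cH'⁻¹ • ((((1 : ℝ) + ε) / 2) • (comp (S κ' u') (X p) - comp (X p) (S κ' u')) + (((1 : ℝ) - ε) / 2) • R p κ' u')) κ' u') κ' u'
            + e3OfK Lc (unitK (sfStep Lc l) (smStep d Lc l) (GcombSh (d := d) Lc l))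
              (fun κ u => (sfStep Lc l * smStep d Lc l)⁻¹ • unitS (sfStep Lc l) (smStep d Lc l)
                (fun κ u => cH'⁻¹ • ((((1 : ℝ) + ε) / 2) • (comp (S κ u) (X p) - comp (X p) (S κ u)) + (((1 : ℝ) - ε) / 2) • R'' p κ u)) κ u) κ' u')) := by
      funext i p κ' u'
      exact divW_halfMember_comb_succ_eq_slaved tabs cE cVH cΛ cE₂ cB Tc hBff hBmm l hcH hTL hTL'' hC hR hR'' ε p κ' u'
    rw [e]
    exact locStencil₂_add hA hE₁
  · -- second slot: PART 2′ (second slot) pointwise, then the ι-WIN letter + the displayed row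
    have hA : LocStencil₂ (fun (κ : Fin (d + 1)) (u : Fin (d + 1) → ℤ) (_ : Fin (d + 1)) (p : Fin (d + 1) → ℤ) =>
        divV (fun κ₁ u₁ => ((1 / 2 : ℝ) • ((fun κ u κ' u' => (cE₂ * (Lc : ℝ) ^ (2 * (d + 1))) • mmRead Lc (K3OfK
            (unitK (sfStep Lc l) (smStep d Lc l) (GcombSh (d := d) Lc l)) Lc
            (unitS (sfStep Lc l) (smStep d Lc l) (SpureCombOf tabs cE cVH cΛ l)) (unitM (sfStep Lc l) (smStep d Lc l) (tabs.M l))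
            (W2SymOfK (unitK (sfStep Lc l) (smStep d Lc l) (GcombSh (d := d) Lc l)) Lc
              (unitS (sfStep Lc l) (smStep d Lc l) (SpureCombOf tabs cE cVH cΛ l)) (unitM (sfStep Lc l) (smStep d Lc l) (tabs.M l)) 0
              (unitM₂ (sfStep Lc l) (smStep d Lc l) (M2Of d Lc tabs.mixFF l))) κ u κ' u') + cB • tabs.vh₂S κ u κ' u')
          + ε • fun κ u κ' u' => sgnK (trK ((fun κ u κ' u' => (cE₂ * (Lc : ℝ) ^ (2 * (d + 1))) • mmRead Lc (K3OfK
            (unitK (sfStep Lc l) (smStep d Lc l) (GcombSh (d := d) Lc l)) Lc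
            (unitS (sfStep Lc l) (smStep d Lc l) (SpureCombOf tabs cE cVH cΛ l)) (unitM (sfStep Lc l) (smStep d Lc l) (tabs.M l))
            (W2SymOfK (unitK (sfStep Lc l) (smStep d Lc l) (GcombSh (d := d) Lc l)) Lc
              (unitS (sfStep Lc l) (smStep d Lc l) (SpureCombOf tabs cE cVH cΛ l)) (unitM (sfStep Lc l) (smStep d Lc l) (tabs.M l)) 0
              (unitM₂ (sfStep Lc l) (smStep d Lc l) (M2Of d Lc tabs.mixFF l))) κ u κ' u') + cB • tabs.vh₂S κ u κ' u') κ u κ' u')))) κ u κ₁ u₁) p) (((d : ℝ) + 1) * (Real.exp δ + 1) * Cb) δ :=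
      fun κ u _ p x z a b => letter_snd_of_locStencil₂ hb hδ κ u p x z a b
    have e : (fun (κ : Fin (d + 1)) (u : Fin (d + 1) → ℤ) (_ : Fin (d + 1)) (p : Fin (d + 1) → ℤ) =>
          divV (fun κ₁ u₁ => ((1 / 2 : ℝ) • (unitS₂ (sfStep Lc (l + 1)) (smStep d Lc (l + 1)) (T2RecOf d Lc (GcombSh Lc) (SpureCombOf tabs cE cVH cΛ) tabs.M cE₂ cB Tc tabs.vh₂S tabs.mixFF (l + 1))
          + ε • fun κ u κ' u' => sgnK (trK (unitS₂ (sfStep Lc (l + 1)) (smStep d Lc (l + 1)) (T2RecOf d Lc (GcombSh Lc) (SpureCombOf tabs cE cVH cΛ) tabs.M cE₂ cB Tc tabs.vh₂S tabs.mixFF (l + 1)) κ u κ' u')))) κ u κ₁ u₁) p)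
        = (fun (κ : Fin (d + 1)) (u : Fin (d + 1) → ℤ) (_ : Fin (d + 1)) (p : Fin (d + 1) → ℤ) =>
            divV (fun κ₁ u₁ => ((1 / 2 : ℝ) • ((fun κ u κ' u' => (cE₂ * (Lc : ℝ) ^ (2 * (d + 1))) • mmRead Lc (K3OfK
            (unitK (sfStep Lc l) (smStep d Lc l) (GcombSh (d := d) Lc l)) Lc
            (unitS (sfStep Lc l) (smStep d Lc l) (SpureCombOf tabs cE cVH cΛ l)) (unitM (sfStep Lc l) (smStep d Lc l) (tabs.M l))
            (W2SymOfK (unitK (sfStep Lc l) (smStep d Lc l) (GcombSh (d := d) Lc l)) Lc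
              (unitS (sfStep Lc l) (smStep d Lc l) (SpureCombOf tabs cE cVH cΛ l)) (unitM (sfStep Lc l) (smStep d Lc l) (tabs.M l)) 0
              (unitM₂ (sfStep Lc l) (smStep d Lc l) (M2Of d Lc tabs.mixFF l))) κ u κ' u') + cB • tabs.vh₂S κ u κ' u')
          + ε • fun κ u κ' u' => sgnK (trK ((fun κ u κ' u' => (cE₂ * (Lc : ℝ) ^ (2 * (d + 1))) • mmRead Lc (K3OfK
            (unitK (sfStep Lc l) (smStep d Lc l) (GcombSh (d := d) Lc l)) Lc
            (unitS (sfStep Lc l) (smStep d Lc l) (SpureCombOf tabs cE cVH cΛ l)) (unitM (sfStep Lc l) (smStep d Lc l) (tabs.M l))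
            (W2SymOfK (unitK (sfStep Lc l) (smStep d Lc l) (GcombSh (d := d) Lc l)) Lc
              (unitS (sfStep Lc l) (smStep d Lc l) (SpureCombOf tabs cE cVH cΛ l)) (unitM (sfStep Lc l) (smStep d Lc l) (tabs.M l)) 0
              (unitM₂ (sfStep Lc l) (smStep d Lc l) (M2Of d Lc tabs.mixFF l))) κ u κ' u') + cB • tabs.vh₂S κ u κ' u') κ u κ' u')))) κ u κ₁ u₁) p)
          + (fun (κ : Fin (d + 1)) (u : Fin (d + 1) → ℤ) (_ : Fin (d + 1)) (p : Fin (d + 1) → ℤ) =>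
            (cE₂ * (Lc : ℝ) ^ (2 * (d + 1)) * ((Lc : ℝ) ^ (d + 1))⁻¹ / 2) •
            (e3OfK Lc (unitK (sfStep Lc l) (smStep d Lc l) (GcombSh (d := d) Lc l))
              (fun κ' u' => (sfStep Lc l * smStep d Lc l)⁻¹ • unitS (sfStep Lc l) (smStep d Lc l)
                (fun κ' u' => cH'⁻¹ • ((((1 : ℝ) + ε) / 2) • (comp (S κ' u') (X p) - comp (X p) (S κ' u')) + (((1 : ℝ) - ε) / 2) • R p κ' u')) κ' u') κ u
            + e3OfK Lc (unitK (sfStep Lc l) (smStep d Lc l) (GcombSh (d := d) Lc l))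
              (fun κ u => (sfStep Lc l * smStep d Lc l)⁻¹ • unitS (sfStep Lc l) (smStep d Lc l)
                (fun κ u => cH'⁻¹ • ((((1 : ℝ) + ε) / 2) • (comp (S κ u) (X p) - comp (X p) (S κ u)) + (((1 : ℝ) - ε) / 2) • R'' p κ u)) κ u) κ u)) := by
      funext κ u i p
      exact divV_snd_halfMember_comb_succ_eq_slaved tabs cE cVH cΛ cE₂ cB Tc hBff hBmm l hcH hTL hTL'' hC hR hR'' ε p κ u
    rw [e]
    exact locStencil₂_add hA hE₂

end Summit.QuantumFields.BalabanUV.Beta.GAN24.CombHalfMemberSlavedDivergenceLetters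

end
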